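import Summits.NavierStokesRegularity.NavierStokesRegularity.Theorems.RungBlowupCofinal.ClassicalWeakStokes
import Literature.Analysis.FluidPDE.KNSSLemma31Homogeneous
import Literature.Analysis.FluidPDE.ClassicalSolutionGlue
import Literature.Analysis.UnboundedOperators.HeatKernelBoundedData
import Literature.Analysis.UnboundedOperators.HeatKernelHeatEquation
import HarnessLib

/-!
# A Liouville theorem for classical ancient solutions of the STOKES system with Type-I decay
# (route `AngularGalerkinLadder`, crux K1 `RungBlowupCofinal`; analytic helper, theorems only)

Cell `ns-blowup`, seat `ns-blowup-circuit` (g12, AGL Lean seat). Helper file for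
`stmt-NavierStokesRegularity-19959` (K1 of route №8) serving the line
`Cruxes/RungBlowupCofinal/Lines/qlwave.lean` (mean–wave rung profiles), support target (S4) of its
card «PURE-WAVE EXCLUSION» — part 2b of the chain: the LINEAR Liouville theorem in physical
variables into which the pure-wave profile equation is transported (assembly file, part 3).

## The statement (`eq_zero_of_classicalStokes_typeI`)

Let `(u, p)` be a classical solution of the STOKES system `∂ₜu = Δu − ∇p`, `div u = 0` on
`(−∞, 0) × E` (`E` a finite-dimensional real inner product space) — rendered WITHOUT a new
predicate as a classical forced Navier–Stokes solution `IsClassicalNSSolutionOn (Iio 0) 1 d u p`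
whose force IS its own nonlinearity, `d(t) = (u(t)·∇)u(t)` — obeying the Type-I bound
`‖u(t, x)‖ ≤ C₀/(‖x‖ + √(−t))`. Then `u ≡ 0` on `(−∞, 0)`.

NO growth condition on the pressure is assumed (parasitic solutions `u = b(t)`, `p = −b'(t)·x` are
excluded by the spatial decay contained in the Type-I bound, not by the pressure).

## Proof (KNSS 2009, Lemma 3.1 by duality — all analytic input is the tree's)

1. `ClassicalWeakStokes.weakStokes_of_classical_one` (part 2a): on every open slab `(a, b)` a
   classical Stokes solution satisfies the weak identity `∫ₐᵇ∫⟪u, ∂ₜψ + Δψ⟫ = 0` for smooth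
   compactly supported divergence-free space–time tests `ψ`.
2. On the slab of physical times `(T − k − 1, T)`, `T < 0`, the velocity is bounded by `C₀/√(−T)`,
   so the tree's two-time identity `exists_ae_eq_heatExtension_add_const_of_weakStokes`
   (KNSS 2009 Lemma 3.1, case `f = 0`, proved in the tree by caloric duality) gives, for almost
   every pair of times `s < t` in the slab, `u(t) = e^{(t−s)Δ}u(s) + β` a.e. in space — everywhere,
   both sides being continuous.
3. Hence the spatial oscillation of `u(t)` is at most `2 sup|u(s)| ≤ 2C₀/√(−s)`; taking `s` in
   deeper and deeper slabs (`s → −∞`, a countable family of slabs, good times of full measure)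
   `u(t)` is constant in space for a.e. `t ∈ (T − 1, T)`, hence `0` by the decay at spatial
   infinity; by continuity in time `u ≡ 0`.

LABEL: KERNEL (linear parabolic Liouville theorem; functional analysis of the heat semigroup).
Nothing here asserts a Theses declaration; no definition, no named fact, no sorry.
WHAT THIS IS NOT: not Navier–Stokes evidence — a statement about the LINEAR Stokes system.
References: [cite: KochNadirashviliSereginSverak2009, Lemma 3.1 and its proof (arXiv:0709.3599v1
p. 7)]; [cite: Leray1934, §III (17) p. 206].
-/

noncomputable section

namespace Summit.NavierStokesRegularity.AngularGalerkinLadderAncientStokesLiouville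

open Set Function MeasureTheory Filter Topology TopologicalSpace InnerProductSpace
open scoped RealInnerProductSpace Laplacian ContDiff
open Literature.Analysis.FluidPDE Literature.Analysis
open Summit.NavierStokesRegularity.AngularGalerkinLadderClassicalWeakStokes

variable {E : Type*} [NormedAddCommGroup E] [InnerProductSpace ℝ E] [FiniteDimensional ℝ E]
  [MeasurableSpace E] [BorelSpace E]

omit [InnerProductSpace ℝ E] [FiniteDimensional ℝ E] [MeasurableSpace E] [BorelSpace E] in
/-- The Type-I constant of a Type-I bounded field is nonnegative. [folklore] -/
private theorem C₀_nonneg {u : ℝ → E → E} {C₀ : ℝ}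
    (hdec : ∀ t < 0, ∀ x, ‖u t x‖ ≤ C₀ / (‖x‖ + Real.sqrt (-t))) : 0 ≤ C₀ := by
  by_contra hneg
  push Not at hneg
  have hpos : 0 < ‖(0 : E)‖ + Real.sqrt (-(-1 : ℝ)) := by
    rw [norm_zero, zero_add]; exact Real.sqrt_pos.2 (by norm_num)
  have h1 := hdec (-1) (by norm_num) 0
  have h2 : C₀ / (‖(0 : E)‖ + Real.sqrt (-(-1 : ℝ))) < 0 := div_neg_of_neg_of_pos hneg hpos
  linarith [norm_nonneg (u (-1) 0)]

/-! ## §1 The two-time caloric identity on past slabs -/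

/-- **Two-time identity on a past slab.** Let `(u, p)` solve the Stokes system classically on
`(−∞, 0) × E` (as a forced classical Navier–Stokes solution whose force is its own
nonlinearity) with the Type-I bound `‖u(t,x)‖ ≤ C₀/(‖x‖ + √−t)`. For `T < 0` and a slab length
`ℓ > 0`, on the slab of physical times `(T − ℓ, T)` there is a set `G` of full measure such that
for all `s < t` in `G`, `u(t) − e^{(t−s)Δ}u(s)` is constant in space (everywhere, both sides
being continuous). This is the tree's KNSS Lemma 3.1 two-time identity
(`exists_ae_eq_heatExtension_add_const_of_weakStokes`) for the time-translate
`z(τ) = u(τ + T − ℓ)` on `(0, ℓ)`, bounded by `C₀/√(−T)` (for `ℓ ≤ 0` the slab is empty and the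
statement is vacuous).
[cite: KochNadirashviliSereginSverak2009, Lemma 3.1 (arXiv:0709.3599v1 p. 7)] -/
theorem exists_good_times_sub_heatExtension_const {u d : ℝ → E → E} {p : ℝ → E → ℝ} {C₀ : ℝ}
    (h : IsClassicalNSSolutionOn (Iio 0) 1 d u p)
    (hd : ∀ t < 0, ∀ x, d t x = convect (u t) (u t) x)
    (hdec : ∀ t < 0, ∀ x, ‖u t x‖ ≤ C₀ / (‖x‖ + Real.sqrt (-t)))
    {T ℓ : ℝ} (hT : T < 0) :
    ∃ G : Set ℝ, G ⊆ Ioo (T - ℓ) T ∧ volume (Ioo (T - ℓ) T \ G) = 0 ∧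
      ∀ s ∈ G, ∀ t ∈ G, s < t → ∃ β : E, ∀ x,
        u t x = UnboundedOperators.heatExtension (u s) (t - s) x + β := by
  haveI : CompleteSpace E := FiniteDimensional.complete ℝ E
  set c : ℝ := T - ℓ with hc
  -- the time-translate `z τ = u (τ + c)` on `(0, ℓ)`
  set z : ℝ → E → E := fun τ => u (τ + c) with hz
  have hshift : ∀ τ ∈ Ioo 0 ℓ, τ + c < 0 := fun τ hτ => by rw [hc]; linarith [hτ.2]
  have hshiftT : ∀ τ ∈ Ioo 0 ℓ, τ + c < T := fun τ hτ => by rw [hc]; linarith [hτ.2]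
  have hpre : Ioo 0 ℓ ⊆ (· + c) ⁻¹' Iio (0 : ℝ) := fun τ hτ => hshift τ hτ
  have hzcl : IsClassicalNSSolutionOn (Ioo 0 ℓ) 1 (fun τ => d (τ + c)) z (fun τ => p (τ + c)) :=
    (h.comp_add_right c).mono hpre (uniqueDiffOn_Ioo 0 ℓ)
  have hzd : ∀ τ ∈ Ioo 0 ℓ, ∀ x, (fun τ => d (τ + c)) τ x = convect (z τ) (z τ) x :=
    fun τ hτ x => hd (τ + c) (hshift τ hτ) x
  -- joint measurability on the slab
  have hcont : ContinuousOn (uncurry z) (Ioo 0 ℓ ×ˢ univ) := hzcl.smooth_velocity.continuousOn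
  have hzm : AEStronglyMeasurable (uncurry z)
      ((volume.restrict (Ioo 0 ℓ)).prod (volume : Measure E)) := by
    have hm : AEStronglyMeasurable (uncurry z) (volume.restrict (Ioo 0 ℓ ×ˢ univ)) :=
      hcont.aestronglyMeasurable (measurableSet_Ioo.prod MeasurableSet.univ)
    rw [Measure.restrict_prod_eq_prod_univ, ← Measure.volume_eq_prod]
    exact hm
  -- the bound `C₀/√(−T)` on the slab
  have hsT : 0 < Real.sqrt (-T) := Real.sqrt_pos.2 (by linarith)
  have hZ : ∀ τ ∈ Ioo 0 ℓ, ∀ x, ‖z τ x‖ ≤ C₀ / Real.sqrt (-T) := by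
    intro τ hτ x
    have h1 := hdec (τ + c) (hshift τ hτ) x
    have hC₀ : 0 ≤ C₀ := C₀_nonneg hdec
    have h2 : Real.sqrt (-T) ≤ ‖x‖ + Real.sqrt (-(τ + c)) := by
      have : Real.sqrt (-T) ≤ Real.sqrt (-(τ + c)) :=
        Real.sqrt_le_sqrt (by linarith [hshiftT τ hτ])
      linarith [norm_nonneg x]
    calc ‖z τ x‖ = ‖u (τ + c) x‖ := rfl
      _ ≤ C₀ / (‖x‖ + Real.sqrt (-(τ + c))) := h1
      _ ≤ C₀ / Real.sqrt (-T) := div_le_div_of_nonneg_left hC₀ hsT h2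
  -- weak divergence-freeness and the weak Stokes identity
  have hzdiv : ∀ᵐ τ ∂(volume.restrict (Ioo 0 ℓ)), IsWeaklyDivFree (z τ) :=
    (ae_restrict_iff' measurableSet_Ioo).2 (Eventually.of_forall fun τ hτ =>
      VectorCalculus.IsDivFree.isWeaklyDivFree_holds (hzcl.divFree τ hτ)
        (contDiff_infty.1 (hzcl.contDiff_velocity hτ) 1))
  have hweak : ∀ ψ : ℝ → E → E, IsSpaceTimeTestOn (slab E (Ioo 0 ℓ) isOpen_Ioo) ψ →
      (∀ t, VectorCalculus.IsDivFree (ψ t)) →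
      ∫ t in Ioo 0 ℓ, ∫ x, ⟪z t x, timeDeriv ψ t x + Δ (ψ t) x⟫ = 0 :=
    fun ψ hψ hψdiv => weakStokes_of_classical_one hzcl hzd ψ hψ hψdiv
  obtain ⟨G, hG, hGnull, -, -, htwo⟩ :=
    exists_ae_eq_heatExtension_add_const_of_weakStokes hzm hZ hzdiv hweak
  -- translate back
  refine ⟨(· + c) '' G, ?_, ?_, ?_⟩
  · rintro _ ⟨τ, hτ, rfl⟩
    have h1 := hG hτ
    exact ⟨by rw [hc]; linarith [h1.1], by rw [hc]; linarith [h1.2]⟩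
  · have himage : Ioo (T - ℓ) T \ (· + c) '' G = (· + c) '' (Ioo 0 ℓ \ G) := by
      ext t
      simp only [Set.mem_sdiff, mem_Ioo, mem_image]
      constructor
      · rintro ⟨⟨h1, h2⟩, h3⟩
        refine ⟨t - c, ⟨⟨by rw [hc]; linarith, by rw [hc]; linarith⟩, fun hG' => h3 ⟨t - c, hG', by ring⟩⟩,
          by ring⟩
      · rintro ⟨τ, ⟨⟨h1, h2⟩, h3⟩, rfl⟩
        refine ⟨⟨by rw [hc]; linarith, by rw [hc]; linarith⟩, ?_⟩
        rintro ⟨τ', hτ', he⟩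
        have : τ' = τ := by linarith
        exact h3 (this ▸ hτ')
    rw [himage, image_add_right, measure_preimage_add_right]
    exact hGnull
  · rintro _ ⟨σ, hσ, rfl⟩ _ ⟨τ, hτ, rfl⟩ hst
    have hστ : σ < τ := by linarith
    obtain ⟨β, hβ⟩ := htwo σ hσ τ hτ hστ
    refine ⟨β, ?_⟩
    -- both sides are continuous, so the a.e. identity holds everywhere
    have hτ0 : τ ∈ Ioo 0 ℓ := hG hτ
    have hσ0 : σ ∈ Ioo 0 ℓ := hG hσ
    have hzc : Continuous (z τ) := (hzcl.contDiff_velocity hτ0).continuous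
    have hzσc : Continuous (z σ) := (hzcl.contDiff_velocity hσ0).continuous
    have hHc : Continuous fun x => UnboundedOperators.heatExtension (z σ) (τ - σ) x + β := by
      have hsm := UnboundedOperators.contDiff_heatExtension_of_bound hzσc (hZ σ hσ0)
        (sub_pos.2 hστ) (m := 0)
      exact hsm.continuous.add continuous_const
    have heq := Continuous.ae_eq_iff_eq volume hzc hHc |>.1 hβ
    intro x
    have hx := congrFun heq x
    have e1 : τ + c - (σ + c) = τ - σ := by ring
    simp only [hz] at hx ⊢
    rw [e1]
    exact hx

/-! ## §2 The Liouville theorem -/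

/-- A set of full measure in a nonempty open interval is nonempty there. [folklore] -/
private theorem nonempty_of_null_diff {a b : ℝ} {G : Set ℝ}
    (hnull : volume (Ioo a b \ G) = 0) {a' b' : ℝ} (ha : a ≤ a') (hb : b' ≤ b) (hab' : a' < b') :
    (G ∩ Ioo a' b').Nonempty := by
  by_contra hne
  rw [not_nonempty_iff_eq_empty] at hne
  have hsub : Ioo a' b' ⊆ Ioo a b \ G := fun t ht =>
    ⟨⟨lt_of_le_of_lt ha ht.1, lt_of_lt_of_le ht.2 hb⟩, fun htG => by
      have : t ∈ G ∩ Ioo a' b' := ⟨htG, ht⟩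
      rw [hne] at this
      exact this⟩
  have h1 : volume (Ioo a' b') = 0 := measure_mono_null hsub hnull
  rw [Real.volume_Ioo, ENNReal.ofReal_eq_zero] at h1
  linarith

/-- **Liouville theorem for classical ancient Stokes solutions with Type-I decay.** Let `(u, p)`
be a classical solution of the Stokes system `∂ₜu = Δu − ∇p`, `div u = 0` on `(−∞, 0) × E`
(rendered as a classical forced Navier–Stokes solution `IsClassicalNSSolutionOn (Iio 0) 1 d u p`
whose force is its own nonlinearity, `d(t) = (u(t)·∇)u(t)`), with the Type-I bound
`‖u(t, x)‖ ≤ C₀/(‖x‖ + √(−t))`. Then `u(t) ≡ 0` for every `t < 0`. No condition on the pressure.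
Proof: by the two-time identity on the slabs `(T − k − 2, T)` (§2), for a.e. `t ∈ (T − 1, T)` the
spatial oscillation of `u(t)` is `≤ 2C₀/√(k + 1 − T)` for every `k` (`‖e^{rΔ}g‖_∞ ≤ ‖g‖_∞`,
tree `norm_heatExtension_le`; two-time identity of §1), so `u(t)` is constant in space, hence zero by the decay; by
continuity in time the conclusion holds at every `t < 0`.
[cite: KochNadirashviliSereginSverak2009, Lemma 3.1 (arXiv:0709.3599v1 p. 7)] -/
theorem eq_zero_of_classicalStokes_typeI {u d : ℝ → E → E} {p : ℝ → E → ℝ} {C₀ : ℝ}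
    (h : IsClassicalNSSolutionOn (Iio 0) 1 d u p)
    (hd : ∀ t < 0, ∀ x, d t x = convect (u t) (u t) x)
    (hdec : ∀ t < 0, ∀ x, ‖u t x‖ ≤ C₀ / (‖x‖ + Real.sqrt (-t))) :
    ∀ t < 0, ∀ x, u t x = 0 := by
  haveI : CompleteSpace E := FiniteDimensional.complete ℝ E
  -- Step 1: for every `T < 0`, `u(t) = 0` for a.e. `t ∈ (T − 1, T)` — in fact on a full-measure set
  have step : ∀ T < 0, ∃ A : Set ℝ, A ⊆ Ioo (T - 1) T ∧ volume (Ioo (T - 1) T \ A) = 0 ∧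
      ∀ t ∈ A, ∀ x, u t x = 0 := by
    intro T hT
    -- slabs `(T − (k+2), T)`, `k : ℕ`
    have hslab : ∀ k : ℕ, ∃ G : Set ℝ, G ⊆ Ioo (T - ((k : ℝ) + 2)) T ∧
        volume (Ioo (T - ((k : ℝ) + 2)) T \ G) = 0 ∧
        ∀ s ∈ G, ∀ t ∈ G, s < t → ∃ β : E, ∀ x,
          u t x = UnboundedOperators.heatExtension (u s) (t - s) x + β :=
      fun k => exists_good_times_sub_heatExtension_const h hd hdec hT
    choose G hGsub hGnull hGtwo using hslab
    -- the good set: times in `(T − 1, T)` lying in every `G k`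
    refine ⟨Ioo (T - 1) T ∩ ⋂ k, G k, fun t ht => ht.1, ?_, ?_⟩
    · have hcover : Ioo (T - 1) T \ (Ioo (T - 1) T ∩ ⋂ k, G k) ⊆
          ⋃ k : ℕ, (Ioo (T - ((k : ℝ) + 2)) T \ G k) := by
        intro t ht
        have ht1 := ht.1
        have hnot : t ∉ ⋂ k, G k := fun hin => ht.2 ⟨ht1, hin⟩
        rw [mem_iInter, not_forall] at hnot
        obtain ⟨k, hk⟩ := hnot
        refine mem_iUnion.2 ⟨k, ⟨?_, ?_⟩, hk⟩
        · have : (0 : ℝ) ≤ k := Nat.cast_nonneg k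
          linarith [ht1.1]
        · exact ht1.2
      exact measure_mono_null hcover (measure_iUnion_null fun k : ℕ => hGnull k)
    · intro t ht x
      obtain ⟨ht1, htG⟩ := ht
      rw [mem_iInter] at htG
      -- oscillation bound from slab `k`
      have hosc : ∀ k : ℕ, ∀ x', ‖u t x - u t x'‖ ≤ 2 * (C₀ / Real.sqrt ((k : ℝ) + 1 - T)) := by
        intro k x'
        -- a good early time `s ∈ G k ∩ (T − (k+2), T − (k+1))`
        obtain ⟨s, hsG, hs⟩ := nonempty_of_null_diff (hGnull k) le_rfl
          (show T - ((k : ℝ) + 1) ≤ T by linarith) (by linarith)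
        have hst : s < t := by linarith [hs.2, ht1.1]
        obtain ⟨β, hβ⟩ := hGtwo k s hsG t (htG k) hst
        have hs0 : s < 0 := by linarith [hs.2]
        -- sup bound of `u s`
        have hroot : Real.sqrt ((k : ℝ) + 1 - T) ≤ Real.sqrt (-s) :=
          Real.sqrt_le_sqrt (by linarith [hs.2])
        have hrpos : 0 < Real.sqrt ((k : ℝ) + 1 - T) := Real.sqrt_pos.2 (by
          have : (0 : ℝ) ≤ k := Nat.cast_nonneg k
          linarith)
        have hC₀ : 0 ≤ C₀ := C₀_nonneg hdec
        have hsup : ∀ y, ‖u s y‖ ≤ C₀ / Real.sqrt ((k : ℝ) + 1 - T) := fun y =>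
          (hdec s hs0 y).trans (div_le_div_of_nonneg_left hC₀ hrpos
            (hroot.trans (by linarith [norm_nonneg y])))
        have hH : ∀ y, ‖UnboundedOperators.heatExtension (u s) (t - s) y‖ ≤
            C₀ / Real.sqrt ((k : ℝ) + 1 - T) := fun y =>
          UnboundedOperators.norm_heatExtension_le hsup (sub_pos.2 hst) y
        rw [hβ x, hβ x']
        calc ‖UnboundedOperators.heatExtension (u s) (t - s) x + β -
              (UnboundedOperators.heatExtension (u s) (t - s) x' + β)‖
            = ‖UnboundedOperators.heatExtension (u s) (t - s) x -
                UnboundedOperators.heatExtension (u s) (t - s) x'‖ := by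
              congr 1; abel
          _ ≤ ‖UnboundedOperators.heatExtension (u s) (t - s) x‖ +
                ‖UnboundedOperators.heatExtension (u s) (t - s) x'‖ := norm_sub_le _ _
          _ ≤ C₀ / Real.sqrt ((k : ℝ) + 1 - T) + C₀ / Real.sqrt ((k : ℝ) + 1 - T) :=
              add_le_add (hH x) (hH x')
          _ = 2 * (C₀ / Real.sqrt ((k : ℝ) + 1 - T)) := by ring
      -- `u t` is constant in space
      have hconst : ∀ x', u t x = u t x' := by
        intro x'
        have hlim : Tendsto (fun k : ℕ => 2 * (C₀ / Real.sqrt ((k : ℝ) + 1 - T))) atTop (𝓝 0) := by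
          have h1 : Tendsto (fun k : ℕ => Real.sqrt ((k : ℝ) + 1 - T)) atTop atTop := by
            refine Real.tendsto_sqrt_atTop.comp ?_
            have : Tendsto (fun k : ℕ => (k : ℝ) + (1 - T)) atTop atTop :=
              tendsto_atTop_add_const_right _ _ tendsto_natCast_atTop_atTop
            exact this.congr fun k => by ring
          have h2 : Tendsto (fun k : ℕ => C₀ / Real.sqrt ((k : ℝ) + 1 - T)) atTop (𝓝 0) :=
            h1.const_div_atTop C₀
          simpa using h2.const_mul 2
        have hle : ‖u t x - u t x'‖ ≤ 0 :=
          ge_of_tendsto' hlim fun k => hosc k x'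
        exact sub_eq_zero.1 (norm_le_zero_iff.1 hle)
      -- and decays at infinity, hence vanishes
      have ht0 : t < 0 := by linarith [ht1.2]
      by_contra hne
      have hpos : 0 < ‖u t x‖ := norm_pos_iff.2 hne
      have hC₀ : 0 ≤ C₀ := C₀_nonneg hdec
      -- pick `x'` with `‖x'‖` large: `C₀/(‖x'‖ + √−t) < ‖u t x‖`
      obtain ⟨e, he⟩ : ∃ e : E, e ≠ 0 := ⟨u t x, hne⟩
      set R : ℝ := (C₀ / ‖u t x‖ + 1) / ‖e‖ with hR
      have hepos : 0 < ‖e‖ := norm_pos_iff.2 he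
      set x' : E := R • e with hx'
      have hnx' : ‖x'‖ = C₀ / ‖u t x‖ + 1 := by
        rw [hx', norm_smul, hR, Real.norm_of_nonneg (by positivity)]
        field_simp
      have h1 := hdec t ht0 x'
      rw [← hconst x'] at h1
      have h2 : C₀ / (‖x'‖ + Real.sqrt (-t)) < ‖u t x‖ := by
        rw [div_lt_iff₀ (by have := Real.sqrt_nonneg (-t); rw [hnx']; positivity), hnx']
        have hs0 : 0 ≤ Real.sqrt (-t) := Real.sqrt_nonneg _
        have : C₀ < ‖u t x‖ * (C₀ / ‖u t x‖ + 1) := by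
          rw [mul_add, mul_div_cancel₀ _ hpos.ne', mul_one]
          linarith
        nlinarith
      linarith
  -- Step 2: continuity in time
  intro t ht x
  set T : ℝ := t / 2 ⊓ (t + 1 / 2) with hT
  have hTlt : T < 0 := by
    have : t / 2 < 0 := by linarith
    exact lt_of_le_of_lt inf_le_left this
  have htT : t < T := by
    rw [hT, lt_inf_iff]; constructor <;> linarith
  have hT1t : T - 1 < t := by
    have : T ≤ t + 1 / 2 := inf_le_right
    linarith
  obtain ⟨A, hA, hAnull, hAzero⟩ := step T hTlt
  -- `t` is in the closure of `A`; `s ↦ u s x` is continuous on `(−∞, 0)`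
  have hcont : ContinuousWithinAt (fun s => u s x) (Iio 0) t := by
    have hc := h.smooth_velocity.continuousOn
    have : ContinuousWithinAt (uncurry u) (Iio 0 ×ˢ univ) (t, x) := hc (t, x) ⟨ht, mem_univ x⟩
    exact this.comp (f := fun s => (s, x)) ((Continuous.prodMk_left x).continuousWithinAt)
      fun s hs => ⟨hs, mem_univ x⟩
  have hmem : t ∈ closure (A ∩ Iio 0) := by
    rw [Metric.mem_closure_iff]
    intro ε hε
    -- a point of `A` in `(t − δ, t + δ) ∩ (T − 1, T)`
    set δ : ℝ := min (ε / 2) (min (t - (T - 1)) (T - t)) with hδ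
    have hδpos : 0 < δ := by
      rw [hδ]; exact lt_min (by linarith) (lt_min (by linarith) (by linarith))
    have hδ1 : δ ≤ ε / 2 := min_le_left _ _
    have hδ2 : δ ≤ t - (T - 1) := (min_le_right _ _).trans (min_le_left _ _)
    have hδ3 : δ ≤ T - t := (min_le_right _ _).trans (min_le_right _ _)
    obtain ⟨s, hsA, hs⟩ := nonempty_of_null_diff hAnull
      (show T - 1 ≤ t - δ by linarith) (show t + δ ≤ T by linarith) (by linarith)
    refine ⟨s, ⟨hsA, (hA hsA).2.trans hTlt⟩, ?_⟩
    rw [Real.dist_eq, abs_lt]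
    constructor <;> linarith [hs.1, hs.2]
  have hzero_on : ∀ s ∈ A ∩ Iio 0, u s x = 0 := fun s hs => hAzero s hs.1 x
  -- pass to the limit
  have hcw : ContinuousWithinAt (fun s => u s x) (A ∩ Iio 0) t :=
    hcont.mono inter_subset_right
  have := hcw.mem_closure_image hmem
  have himg : (fun s => u s x) '' (A ∩ Iio 0) ⊆ {0} := by
    rintro _ ⟨s, hs, rfl⟩
    exact hzero_on s hs
  have hcl : closure ((fun s => u s x) '' (A ∩ Iio 0)) ⊆ {0} :=
    (closure_mono himg).trans (by rw [closure_singleton])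
  exact hcl this

end Summit.NavierStokesRegularity.AngularGalerkinLadderAncientStokesLiouville

end
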